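import Literature.Analysis.FluidPDE.NecasRuzickaSverakRiesz
import HarnessLib

/-!
# The space–time Riesz pressure of an `L^{2q}(ℝ × ℝ³)` field at a general exponent

Analysis/FluidPDE proof file (theorems; one small definition, the slice pressure field) in the
DAG below the named fact `Literature.Analysis.FluidPDE.bradshawTsai2017_thm_2_4_mollified`
(`PeriodicLerayExistence.lean`; Bradshaw–Tsai, Ann. Henri Poincaré 18 (2017) = arXiv:1510.07504
[BT1], Lemma 2.6 with the first part of the proof of Thm 2.4). The pressure of the mollified
approximants there is "`p̃_ε = Σ RᵢRⱼ[(η_ε*Uᵢ)Uⱼ + WᵢUⱼ + UᵢWⱼ + WᵢWⱼ]` … apply the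
Calderon–Zygmund theory to obtain an a priori bound for `p_ε`:
`‖p_ε‖_{L^{5/3}(ℝ³×[0,T])} ≤ C‖U_ε‖²_{L^{10/3}(ℝ³×[0,T])} + C‖W‖²_{L^{10/3}(ℝ³×[0,T])}`" — a Riesz
pressure at the exponent `10/3 → 5/3` of fields with **no time regularity** (`U_ε` is a weak
limit), which must nevertheless be a jointly measurable function of `(s, y)` to enter the
distributional equation and the local energy balance. The tree has this space–time construction
for `L³ → L^{3/2}` only (`RieszPressureSpaceTimeLp.lean`, along the canonical operator
`rieszPressure` of `RieszPressureL3.lean` and the `L³`-continuous curves of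
`RieszPressureSpaceTime.lean`), and the slice-wise existence at a general exponent
(`exists_rieszPressure`, `NecasRuzickaSverakRiesz.lean`). This file proves the space–time
statement at a general exponent `1 < q < ∞` directly:

* `RieszPressureLq.exists_spaceTime_rieszPressure` — there is `C` such that every
  `u ∈ L^{2q}(ℝ × ℝ³; ℝ³)` admits `Q ∈ L^q(ℝ × ℝ³)` with `‖Q‖_q ≤ C‖u‖²_{2q}` and, for a.e. `s`,
  `u(s,·) ∈ L^{2q}(ℝ³)`, `Q(s,·) ∈ L^q(ℝ³)` and `∫ Q(s,·)Δφ = −∫ D²φ(u(s,·),u(s,·))` for all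
  `φ ∈ C_c^∞(ℝ³)` (fields on a time slab are handled by zero extension; bilinear sources
  `bᵢUⱼ + uᵢWⱼ` by polarisation, in the sibling assembling [BT1]'s `p̃_ε`).

## The argument (no canonical operator, no time continuity)

Run the construction of `exists_rieszPressure` on space–time. Approximate `u` in
`L^{2q}(ℝ × ℝ³)` by smooth compactly supported space–time fields `wₙ` with `‖u − wₙ‖_{2q} ≤ 2⁻ⁿ`
(Mathlib's `MemLp.exist_eLpNorm_sub_le`). For such `w` the **slice pressure field**
`P[w](s,y) = p̃[w(s,·)](y)` (`slicePressure`; `p̃ = normalisedPressure`) is strongly measurable on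
`ℝ × ℝ³`: it is the pointwise limit (`tendsto_regPressure_nat`) of the regularised slice pressures
`Q_ε[w(s,·)](y) = −∫ D²Φ_ε(y − t)(w(s,t), w(s,t)) dt`, which are jointly continuous (a parametric
integral over the compact space support, `continuous_parametric_integral_of_continuous`). The
slice-wise Calderón–Zygmund bounds with the constant of the regularised pressures
(`eLpNorm_normalisedPressure_le_of_reg`, and `eLpNorm_normalisedPressure_sub_le_of_reg` for
differences by polarisation) are raised to the power `q`, where they become linear in the slice
integrals `∫|w(s,·)|^{2q}`, and integrated in time (Tonelli): `∫∫|P[w]|^q ≤ C^q∫∫|w|^{2q}` and the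
difference bound; taking `q`-th roots (`(x^q + y^q)^{1/q} ≤ x + y`) returns bounds of the
slice-wise shape on `L^q(ℝ × ℝ³)` with the constant doubled. Hence `P[wₙ]` is Cauchy in
`L^q(ℝ × ℝ³)` with geometric rate and converges to some `Q` (`Lp.cauchy_complete_eLpNorm`), with
`‖Q‖_q ≤ C‖u‖²_{2q}` and the rate `‖P[wₙ] − Q‖_q ≲ 2⁻ⁿ`. The rates make
`Σₙ ∫∫|wₙ − u|^{2q}` and `Σₙ ∫∫|P[wₙ] − Q|^q` finite, so by Tonelli, for a.e. `s`, the slice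
distances are summable in `n`: `wₙ(s) → u(s)` in `L^{2q}(ℝ³)` with a uniform bound and
`P[wₙ](s) → Q(s)` in `L^q(ℝ³)`; the exact weak Poisson equations of the slices `p̃[wₙ(s)]`
(`integral_normalisedPressure_mul_laplacian`) then pass to the limit by the two Hölder lemmas of
`NecasRuzickaSverakRiesz.lean`.

## Mathlib / tree search

Tree (all used): `regPressure`, `hessReg`, `continuous_hessReg`, `normalisedPressure_eq_limPressure`,
`tendsto_regPressure_nat` (`NormalisedPressureL2Bound`); `exists_eLpNorm_regPressure_le`
(`NormalisedPressureLpBoundProofs`); `integral_normalisedPressure_mul_laplacian`,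
`memLp_normalisedPressure_of_hasCompactSupport` (`NormalisedPressureCompactSupport`);
`eLpNorm_normalisedPressure_le_of_reg`, `eLpNorm_normalisedPressure_sub_le_of_reg`,
`eLpNorm_norm_sq_eq_mul_two`, `holderTriple_conj`, `tendsto_integral_mul_of_eLpNorm_tendsto_zero`,
`tendsto_integral_hessian_apply_of_eLpNorm` (`NecasRuzickaSverakRiesz`).
`lean search 'spaceTime_rieszPressure|slicePressure'`: only the `L³` files named above; nothing
at a general exponent. Mathlib: `MemLp.exist_eLpNorm_sub_le`, `Lp.cauchy_complete_eLpNorm`,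
`stronglyMeasurable_of_tendsto`, `continuous_parametric_integral_of_continuous`, `lintegral_prod`,
`lintegral_tsum`, `ae_lt_top'`, `AEStronglyMeasurable.prodMk_left`,
`ENNReal.rpow_add_le_mul_rpow_add_rpow`, `ENNReal.rpow_add_rpow_le_add`,
`ENNReal.tendsto_atTop_zero_of_tsum_ne_top`.

## References

* J. Nečas, M. Růžička, V. Šverák, Acta Math. 176 (1996) 283–294, §2 p. 285 (the Riesz pressure
  of an `L^{2q}` field) [NecasRuzickaSverak1996].
* Z. Bradshaw, T.-P. Tsai, Ann. Henri Poincaré 18 (2017) 1095–1119 = arXiv:1510.07504, §2,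
  proof of Thm 2.4 (the pressure `p̃_ε` and its `L^{5/3}(ℝ³ × [0,T])` bound) [BradshawTsai2017AHP].
* E. M. Stein, *Singular integrals and differentiability properties of functions* (1970),
  Ch. II §4.2 Thm 3 [Stein1971].
-/

noncomputable section

open MeasureTheory Set Filter Topology Function Metric
open scoped ENNReal NNReal RealInnerProductSpace ContDiff Laplacian

namespace Literature.Analysis.FluidPDE

-- nested operator types `ℝ³ →L[ℝ] ℝ³ →L[ℝ] ℝ`
set_option maxSynthPendingDepth 3

/-- Local notation for physical space `ℝ³ = EuclideanSpace ℝ (Fin 3)`. -/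
local notation "ℝ³" => EuclideanSpace ℝ (Fin 3)

namespace RieszPressureLq

/-! ## §0. Tonelli bookkeeping on `ℝ × ℝ³` -/

section Tonelli

variable {G : Type*} [NormedAddCommGroup G]

/-- Lebesgue measure on `ℝ × ℝ³` is the product measure. [folklore] -/
theorem volume_eq_prod₄ : (volume : Measure (ℝ × ℝ³)) = (volume : Measure ℝ).prod (volume : Measure ℝ³) :=
  rfl

/-- **Tonelli for powers of the norm**: `∫∫ |F|^p = ∫ (∫ |F(s,·)|^p) ds` for an a.e. strongly
measurable `F` on `ℝ × ℝ³`. [folklore] -/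
theorem lintegral_enorm_rpow_eq_lintegral_lintegral {F : ℝ × ℝ³ → G}
    (hF : AEStronglyMeasurable F volume) (p : ℝ) :
    ∫⁻ z, ‖F z‖ₑ ^ p = ∫⁻ s, ∫⁻ y, ‖F (s, y)‖ₑ ^ p := by
  rw [volume_eq_prod₄, lintegral_prod _ (hF.enorm.pow_const p)]

/-- The slice integrals `s ↦ ∫ |F(s,·)|^p` are a.e. measurable. [folklore] -/
theorem aemeasurable_lintegral_slice {F : ℝ × ℝ³ → G} (hF : AEStronglyMeasurable F volume) (p : ℝ) :
    AEMeasurable (fun s => ∫⁻ y, ‖F (s, y)‖ₑ ^ p) volume :=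
  (hF.enorm.pow_const p).lintegral_prod_right'

/-- `∫ |f|^{P} = ‖f‖_{L^P}^{P}` for `0 < P < ∞` (bookkeeping). [folklore] -/
theorem lintegral_enorm_rpow_eq_eLpNorm_rpow {α : Type*} [MeasurableSpace α] (μ : Measure α)
    (f : α → G) {P : ℝ≥0∞} (hP0 : P ≠ 0) (hPtop : P ≠ ⊤) :
    ∫⁻ x, ‖f x‖ₑ ^ P.toReal ∂μ = eLpNorm f P μ ^ P.toReal := by
  have hP : 0 < P.toReal := ENNReal.toReal_pos hP0 hPtop
  rw [eLpNorm_eq_lintegral_rpow_enorm_toReal hP0 hPtop, ← ENNReal.rpow_mul, one_div_mul_cancel hP.ne',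
    ENNReal.rpow_one]

/-- **A.e. slice of an `L^P(ℝ × ℝ³)` function is in `L^P(ℝ³)`** (Tonelli), `0 < P < ∞`.
[folklore] -/
theorem ae_memLp_slice {F : ℝ × ℝ³ → G} {P : ℝ≥0∞} (hP0 : P ≠ 0) (hPtop : P ≠ ⊤)
    (hF : MemLp F P volume) : ∀ᵐ s : ℝ, MemLp (fun y => F (s, y)) P volume := by
  have hm : ∀ᵐ s : ℝ, AEStronglyMeasurable (fun y => F (s, y)) volume := by
    have h := hF.1
    rw [volume_eq_prod₄] at h
    exact h.prodMk_left
  have hlt : ∫⁻ s, ∫⁻ y, ‖F (s, y)‖ₑ ^ P.toReal < ⊤ := by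
    rw [← lintegral_enorm_rpow_eq_lintegral_lintegral hF.1]
    exact (eLpNorm_lt_top_iff_lintegral_rpow_enorm_lt_top hP0 hPtop).1 hF.2
  have hfin := ae_lt_top' (aemeasurable_lintegral_slice hF.1 P.toReal) hlt.ne
  filter_upwards [hm, hfin] with s hs hfs
  exact ⟨hs, (eLpNorm_lt_top_iff_lintegral_rpow_enorm_lt_top hP0 hPtop).2 hfs⟩

/-- **Slice-wise convergence from summable space–time norms** (Tonelli and `∑ ∫ < ∞`): if
`∑ₙ ∫∫ |Fₙ|^p < ∞` then for a.e. `s`, `∑ₙ ∫ |Fₙ(s,·)|^p < ∞`, so that the slice integrals tend to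
`0` and are bounded by the (finite) sum. [folklore] -/
theorem ae_tsum_lintegral_slice_ne_top {F : ℕ → ℝ × ℝ³ → G} (hF : ∀ n, AEStronglyMeasurable (F n) volume)
    {p : ℝ} (hsum : ∑' n, ∫⁻ z, ‖F n z‖ₑ ^ p ≠ ⊤) :
    ∀ᵐ s : ℝ, ∑' n, ∫⁻ y, ‖F n (s, y)‖ₑ ^ p ≠ ⊤ := by
  have h1 : ∫⁻ s, ∑' n, ∫⁻ y, ‖F n (s, y)‖ₑ ^ p ≠ ⊤ := by
    rw [lintegral_tsum fun n => aemeasurable_lintegral_slice (hF n) p]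
    simp_rw [← lintegral_enorm_rpow_eq_lintegral_lintegral (hF _)]
    exact hsum
  have hae := ae_lt_top' (AEMeasurable.tsum fun n => aemeasurable_lintegral_slice (hF n) p) h1
  filter_upwards [hae] with s hs
  exact hs.ne

end Tonelli

/-! ## §1. Slice pressures of smooth compactly supported space–time fields -/

section SlicePressure

variable {w : ℝ × ℝ³ → ℝ³}

/-- The space projection of the support of a compactly supported space–time field is compact,
and every slice vanishes off it. [folklore] -/
theorem exists_compact_forall_slice_eq_zero (hwc : HasCompactSupport w) :
    ∃ K : Set ℝ³, IsCompact K ∧ ∀ s y, y ∉ K → w (s, y) = 0 := by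
  refine ⟨Prod.snd '' tsupport w, hwc.isCompact.image continuous_snd, fun s y hy => ?_⟩
  by_contra h
  exact hy ⟨(s, y), subset_tsupport _ h, rfl⟩

/-- The slices of a smooth space–time field are smooth. [folklore] -/
theorem contDiff_slice {n : WithTop ℕ∞} (hw : ContDiff ℝ n w) (s : ℝ) : ContDiff ℝ n fun y => w (s, y) :=
  hw.comp (contDiff_prodMk_right s)

/-- The slices of a compactly supported space–time field have compact support. [folklore] -/
theorem hasCompactSupport_slice' (hwc : HasCompactSupport w) (s : ℝ) :
    HasCompactSupport fun y => w (s, y) := by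
  obtain ⟨K, hK, h0⟩ := exists_compact_forall_slice_eq_zero hwc
  exact HasCompactSupport.intro hK fun y hy => h0 s y hy

/-- **The slice pressure field** `P[w](s, y) = p̃[w(s, ·)](y)`: the normalised pressure
`p̃ = -Δ⁻¹∂ᵢ∂ⱼ(wᵢwⱼ)` (`normalisedPressure`) of each time slice of a space–time field. [folklore] -/
def slicePressure (w : ℝ × ℝ³ → ℝ³) (z : ℝ × ℝ³) : ℝ :=
  normalisedPressure (fun y => w (z.1, y)) z.2

/-- Unfolding `slicePressure`. [folklore] -/
theorem slicePressure_apply (w : ℝ × ℝ³ → ℝ³) (z : ℝ × ℝ³) :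
    slicePressure w z = normalisedPressure (fun y => w (z.1, y)) z.2 := rfl

/-- **Joint continuity of the regularised slice pressures** `(s, y) ↦ Q_ε[w(s,·)](y) =
-∫ D²Φ_ε(y − t)(w(s,t), w(s,t)) dt` for a continuous compactly supported space–time field
(a parametric integral over the compact space support). [folklore] -/
theorem continuous_regPressure_slice (hw : Continuous w) (hwc : HasCompactSupport w) (ε : ℝ) :
    Continuous fun z : ℝ × ℝ³ => regPressure ε (fun y => w (z.1, y)) z.2 := by
  obtain ⟨K, hK, h0⟩ := exists_compact_forall_slice_eq_zero hwc
  -- the integrand as a function of `(z, t)`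
  set F : ℝ × ℝ³ → ℝ³ → ℝ := fun z t => hessReg ε (z.2 - t) (w (z.1, t)) (w (z.1, t)) with hF
  have hFc : Continuous F.uncurry := by
    have h1 : Continuous fun q : (ℝ × ℝ³) × ℝ³ => hessReg ε (q.1.2 - q.2) :=
      (continuous_hessReg ε).comp ((continuous_snd.comp continuous_fst).sub continuous_snd)
    have h2 : Continuous fun q : (ℝ × ℝ³) × ℝ³ => w (q.1.1, q.2) :=
      hw.comp ((continuous_fst.comp continuous_fst).prodMk continuous_snd)
    exact (h1.clm_apply h2).clm_apply h2
  have hcont : Continuous fun z : ℝ × ℝ³ => ∫ t in K, F z t :=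
    continuous_parametric_integral_of_continuous hFc hK
  have heq : (fun z : ℝ × ℝ³ => regPressure ε (fun y => w (z.1, y)) z.2) = fun z => -∫ t in K, F z t := by
    funext z
    rw [regPressure]
    congr 1
    refine (setIntegral_eq_integral_of_forall_compl_eq_zero fun t ht => ?_).symm
    show hessReg ε (z.2 - t) (w (z.1, t)) (w (z.1, t)) = 0
    rw [h0 z.1 t ht, map_zero]
  rw [heq]
  exact hcont.neg

/-- **The slice pressure field of a smooth compactly supported space–time field is strongly
measurable** (it is the pointwise limit of the jointly continuous regularised slice pressures
`Q_{1/(n+1)}[w(s,·)](y)`). [folklore] -/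
theorem stronglyMeasurable_slicePressure (hw : ContDiff ℝ ∞ w) (hwc : HasCompactSupport w) :
    StronglyMeasurable (slicePressure w) := by
  refine stronglyMeasurable_of_tendsto (f := fun n : ℕ => fun z : ℝ × ℝ³ =>
    regPressure (1 / ((n : ℝ) + 1)) (fun y => w (z.1, y)) z.2) atTop
    (fun n => (continuous_regPressure_slice hw.continuous hwc _).stronglyMeasurable) ?_
  rw [tendsto_pi_nhds]
  intro z
  rw [slicePressure_apply, normalisedPressure_eq_limPressure (contDiff_slice hw z.1)
    (hasCompactSupport_slice' hwc z.1)]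
  exact tendsto_regPressure_nat (contDiff_slice hw z.1) (hasCompactSupport_slice' hwc z.1) z.2

end SlicePressure

/-! ## §2. The `L^P` bounds for slice pressures, slice-wise and integrated in time -/

section Bounds

variable {P : ℝ≥0∞} {C : ℝ≥0}

/-- `(P·2).toReal = 2 P.toReal`. [folklore] -/
theorem toReal_mul_two (P : ℝ≥0∞) : (P * 2).toReal = 2 * P.toReal := by
  rw [ENNReal.toReal_mul, ENNReal.toReal_ofNat]; ring

/-- `(N²)^{p} = N^{2p}` in `ℝ≥0∞`, `p ≥ 0`. [folklore] -/
theorem sq_rpow_eq_rpow_two_mul (N : ℝ≥0∞) {p : ℝ} :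
    (N ^ 2) ^ p = N ^ (2 * p) := by
  rw [← ENNReal.rpow_natCast N 2, ← ENNReal.rpow_mul]; norm_num

/-- **Slice bound, integral form**: `∫ |p̃[w]|^p ≤ C^p ∫ |w|^{2p}` for `w ∈ C_c^∞(ℝ³)`, from the
`L^P` bound with the constant of the regularised pressures (`p = P.toReal`). [folklore] -/
theorem lintegral_normalisedPressure_rpow_le (hP1 : 1 < P) (hPtop : P < ⊤)
    (hC : ∀ ε : ℝ, 0 < ε → ∀ w : ℝ³ → ℝ³, Continuous w → HasCompactSupport w →
      eLpNorm (regPressure ε w) P volume ≤ C * eLpNorm (fun y => ‖w y‖ ^ 2) P volume)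
    {w : ℝ³ → ℝ³} (hw : ContDiff ℝ ∞ w) (hwc : HasCompactSupport w) :
    ∫⁻ y, ‖normalisedPressure w y‖ₑ ^ P.toReal ≤
      (C : ℝ≥0∞) ^ P.toReal * ∫⁻ y, ‖w y‖ₑ ^ (P * 2).toReal := by
  have hP0 : P ≠ 0 := (zero_lt_one.trans hP1).ne'
  have hPt : P ≠ ⊤ := hPtop.ne
  have hP20 : P * 2 ≠ 0 := mul_ne_zero hP0 two_ne_zero
  have hP2t : P * 2 ≠ ⊤ := ENNReal.mul_ne_top hPt ENNReal.ofNat_ne_top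
  have hp : 0 ≤ P.toReal := ENNReal.toReal_nonneg
  have h := eLpNorm_normalisedPressure_le_of_reg hC hw hwc
  rw [eLpNorm_norm_sq_eq_mul_two] at h
  have h' := ENNReal.rpow_le_rpow h hp
  rw [ENNReal.mul_rpow_of_nonneg _ _ hp, sq_rpow_eq_rpow_two_mul, ← toReal_mul_two,
    ← lintegral_enorm_rpow_eq_eLpNorm_rpow volume _ hP20 hP2t,
    ← lintegral_enorm_rpow_eq_eLpNorm_rpow volume _ hP0 hPt] at h'
  exact h'

/-- **Slice difference bound, integral form**: for `v, w ∈ C_c^∞(ℝ³)` and `t > 0`,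
`∫ |p̃[v] − p̃[w]|^p ≤ 2^{p−1} C^p ((2t²)^p ∫|v + w|^{2p} + (2t⁻²)^p ∫|v − w|^{2p})`
(the polarisation bound raised to the power `p = P.toReal`, `(a + b)^p ≤ 2^{p−1}(a^p + b^p)`).
[folklore] -/
theorem lintegral_normalisedPressure_sub_rpow_le (hP1 : 1 < P) (hPtop : P < ⊤)
    (hC : ∀ ε : ℝ, 0 < ε → ∀ w : ℝ³ → ℝ³, Continuous w → HasCompactSupport w →
      eLpNorm (regPressure ε w) P volume ≤ C * eLpNorm (fun y => ‖w y‖ ^ 2) P volume)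
    {v w : ℝ³ → ℝ³} (hv : ContDiff ℝ ∞ v) (hvc : HasCompactSupport v) (hw : ContDiff ℝ ∞ w)
    (hwc : HasCompactSupport w) {t : ℝ} (ht : 0 < t) :
    ∫⁻ y, ‖normalisedPressure v y - normalisedPressure w y‖ₑ ^ P.toReal ≤
      2 ^ (P.toReal - 1) * (C : ℝ≥0∞) ^ P.toReal *
        ((ENNReal.ofReal (t ^ 2) * 2) ^ P.toReal * (∫⁻ y, ‖v y + w y‖ₑ ^ (P * 2).toReal) +
          (ENNReal.ofReal (t⁻¹ ^ 2) * 2) ^ P.toReal * ∫⁻ y, ‖v y - w y‖ₑ ^ (P * 2).toReal) := by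
  have hP0 : P ≠ 0 := (zero_lt_one.trans hP1).ne'
  have hPt : P ≠ ⊤ := hPtop.ne
  have hP20 : P * 2 ≠ 0 := mul_ne_zero hP0 two_ne_zero
  have hP2t : P * 2 ≠ ⊤ := ENNReal.mul_ne_top hPt ENNReal.ofNat_ne_top
  have hp : 0 ≤ P.toReal := ENNReal.toReal_nonneg
  have hp1 : 1 ≤ P.toReal := by
    have := (ENNReal.toReal_le_toReal ENNReal.one_ne_top hPt).2 hP1.le
    simpa using this
  have h := eLpNorm_normalisedPressure_sub_le_of_reg hP1.le hC hv hvc hw hwc ht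
  have h' := ENNReal.rpow_le_rpow h hp
  rw [← lintegral_enorm_rpow_eq_eLpNorm_rpow volume _ hP0 hPt] at h'
  refine h'.trans ?_
  set a : ℝ≥0∞ := ENNReal.ofReal (t ^ 2) * (2 * eLpNorm (v + w) (P * 2) volume ^ 2) with ha
  set b : ℝ≥0∞ := ENNReal.ofReal (t⁻¹ ^ 2) * (2 * eLpNorm (v - w) (P * 2) volume ^ 2) with hb
  have hab : (a + b) ^ P.toReal ≤ 2 ^ (P.toReal - 1) * (a ^ P.toReal + b ^ P.toReal) :=
    ENNReal.rpow_add_le_mul_rpow_add_rpow a b hp1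
  have ea : a ^ P.toReal = (ENNReal.ofReal (t ^ 2) * 2) ^ P.toReal * ∫⁻ y, ‖v y + w y‖ₑ ^ (P * 2).toReal := by
    rw [ha, show ENNReal.ofReal (t ^ 2) * (2 * eLpNorm (v + w) (P * 2) volume ^ 2) =
        (ENNReal.ofReal (t ^ 2) * 2) * eLpNorm (v + w) (P * 2) volume ^ 2 by ring,
      ENNReal.mul_rpow_of_nonneg _ _ hp, sq_rpow_eq_rpow_two_mul, ← toReal_mul_two,
      ← lintegral_enorm_rpow_eq_eLpNorm_rpow volume _ hP20 hP2t]
    rfl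
  have eb : b ^ P.toReal = (ENNReal.ofReal (t⁻¹ ^ 2) * 2) ^ P.toReal * ∫⁻ y, ‖v y - w y‖ₑ ^ (P * 2).toReal := by
    rw [hb, show ENNReal.ofReal (t⁻¹ ^ 2) * (2 * eLpNorm (v - w) (P * 2) volume ^ 2) =
        (ENNReal.ofReal (t⁻¹ ^ 2) * 2) * eLpNorm (v - w) (P * 2) volume ^ 2 by ring,
      ENNReal.mul_rpow_of_nonneg _ _ hp, sq_rpow_eq_rpow_two_mul, ← toReal_mul_two,
      ← lintegral_enorm_rpow_eq_eLpNorm_rpow volume _ hP20 hP2t]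
    rfl
  calc ((C : ℝ≥0∞) * (a + b)) ^ P.toReal = (C : ℝ≥0∞) ^ P.toReal * (a + b) ^ P.toReal :=
        ENNReal.mul_rpow_of_nonneg _ _ hp
    _ ≤ (C : ℝ≥0∞) ^ P.toReal * (2 ^ (P.toReal - 1) * (a ^ P.toReal + b ^ P.toReal)) := by gcongr
    _ = _ := by rw [ea, eb]; ring

variable {v w : ℝ × ℝ³ → ℝ³}

/-- **Space–time bound, integral form**: `∫∫ |P[w]|^p ≤ C^p ∫∫ |w|^{2p}` for
`w ∈ C_c^∞(ℝ × ℝ³)` (the slice bound integrated in time, Tonelli). [folklore] -/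
theorem lintegral_slicePressure_rpow_le (hP1 : 1 < P) (hPtop : P < ⊤)
    (hC : ∀ ε : ℝ, 0 < ε → ∀ w : ℝ³ → ℝ³, Continuous w → HasCompactSupport w →
      eLpNorm (regPressure ε w) P volume ≤ C * eLpNorm (fun y => ‖w y‖ ^ 2) P volume)
    (hw : ContDiff ℝ ∞ w) (hwc : HasCompactSupport w) :
    ∫⁻ z, ‖slicePressure w z‖ₑ ^ P.toReal ≤
      (C : ℝ≥0∞) ^ P.toReal * ∫⁻ z, ‖w z‖ₑ ^ (P * 2).toReal := by
  have h1 : ∫⁻ z, ‖slicePressure w z‖ₑ ^ P.toReal =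
      ∫⁻ s, ∫⁻ y, ‖normalisedPressure (fun y => w (s, y)) y‖ₑ ^ P.toReal :=
    lintegral_enorm_rpow_eq_lintegral_lintegral
      (stronglyMeasurable_slicePressure hw hwc).aestronglyMeasurable P.toReal
  have h2 : ∫⁻ z, ‖w z‖ₑ ^ (P * 2).toReal = ∫⁻ s, ∫⁻ y, ‖w (s, y)‖ₑ ^ (P * 2).toReal :=
    lintegral_enorm_rpow_eq_lintegral_lintegral hw.continuous.aestronglyMeasurable _
  have hCtop : (C : ℝ≥0∞) ^ P.toReal ≠ ⊤ :=
    ENNReal.rpow_ne_top_of_nonneg ENNReal.toReal_nonneg ENNReal.coe_ne_top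
  rw [h1, h2, ← lintegral_const_mul' _ _ hCtop]
  exact lintegral_mono fun s => lintegral_normalisedPressure_rpow_le hP1 hPtop hC
    (contDiff_slice hw s) (hasCompactSupport_slice' hwc s)

/-- **Space–time difference bound, integral form** (the slice difference bound integrated in
time). [folklore] -/
theorem lintegral_slicePressure_sub_rpow_le (hP1 : 1 < P) (hPtop : P < ⊤)
    (hC : ∀ ε : ℝ, 0 < ε → ∀ w : ℝ³ → ℝ³, Continuous w → HasCompactSupport w →
      eLpNorm (regPressure ε w) P volume ≤ C * eLpNorm (fun y => ‖w y‖ ^ 2) P volume)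
    (hv : ContDiff ℝ ∞ v) (hvc : HasCompactSupport v) (hw : ContDiff ℝ ∞ w)
    (hwc : HasCompactSupport w) {t : ℝ} (ht : 0 < t) :
    ∫⁻ z, ‖slicePressure v z - slicePressure w z‖ₑ ^ P.toReal ≤
      2 ^ (P.toReal - 1) * (C : ℝ≥0∞) ^ P.toReal *
        ((ENNReal.ofReal (t ^ 2) * 2) ^ P.toReal * (∫⁻ z, ‖v z + w z‖ₑ ^ (P * 2).toReal) +
          (ENNReal.ofReal (t⁻¹ ^ 2) * 2) ^ P.toReal * ∫⁻ z, ‖v z - w z‖ₑ ^ (P * 2).toReal) := by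
  have hp1 : 1 ≤ P.toReal := by
    have := (ENNReal.toReal_le_toReal ENNReal.one_ne_top hPtop.ne).2 hP1.le
    simpa using this
  have hmP : AEStronglyMeasurable (fun z => slicePressure v z - slicePressure w z) volume :=
    (stronglyMeasurable_slicePressure hv hvc).aestronglyMeasurable.sub
      (stronglyMeasurable_slicePressure hw hwc).aestronglyMeasurable
  have hmp : AEStronglyMeasurable (fun z => v z + w z) volume :=
    hv.continuous.aestronglyMeasurable.add hw.continuous.aestronglyMeasurable
  have hmm : AEStronglyMeasurable (fun z => v z - w z) volume :=
    hv.continuous.aestronglyMeasurable.sub hw.continuous.aestronglyMeasurable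
  have h0 : ∫⁻ z, ‖slicePressure v z - slicePressure w z‖ₑ ^ P.toReal =
      ∫⁻ s, ∫⁻ y, ‖normalisedPressure (fun y => v (s, y)) y -
        normalisedPressure (fun y => w (s, y)) y‖ₑ ^ P.toReal :=
    lintegral_enorm_rpow_eq_lintegral_lintegral hmP P.toReal
  have h1 : ∫⁻ z, ‖v z + w z‖ₑ ^ (P * 2).toReal = ∫⁻ s, ∫⁻ y, ‖v (s, y) + w (s, y)‖ₑ ^ (P * 2).toReal :=
    lintegral_enorm_rpow_eq_lintegral_lintegral hmp _
  have h2 : ∫⁻ z, ‖v z - w z‖ₑ ^ (P * 2).toReal = ∫⁻ s, ∫⁻ y, ‖v (s, y) - w (s, y)‖ₑ ^ (P * 2).toReal :=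
    lintegral_enorm_rpow_eq_lintegral_lintegral hmm _
  have htop1 : (ENNReal.ofReal (t ^ 2) * 2) ^ P.toReal ≠ ⊤ :=
    ENNReal.rpow_ne_top_of_nonneg ENNReal.toReal_nonneg
      (ENNReal.mul_ne_top ENNReal.ofReal_ne_top ENNReal.ofNat_ne_top)
  have htop2 : (ENNReal.ofReal (t⁻¹ ^ 2) * 2) ^ P.toReal ≠ ⊤ :=
    ENNReal.rpow_ne_top_of_nonneg ENNReal.toReal_nonneg
      (ENNReal.mul_ne_top ENNReal.ofReal_ne_top ENNReal.ofNat_ne_top)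
  have htopK : 2 ^ (P.toReal - 1) * (C : ℝ≥0∞) ^ P.toReal ≠ ⊤ :=
    ENNReal.mul_ne_top (ENNReal.rpow_ne_top_of_nonneg (by linarith) ENNReal.ofNat_ne_top)
      (ENNReal.rpow_ne_top_of_nonneg ENNReal.toReal_nonneg ENNReal.coe_ne_top)
  have hmA : AEMeasurable (fun s => (ENNReal.ofReal (t ^ 2) * 2) ^ P.toReal *
      ∫⁻ y, ‖v (s, y) + w (s, y)‖ₑ ^ (P * 2).toReal) volume :=
    (aemeasurable_lintegral_slice hmp _).const_mul _
  rw [h0, h1, h2, ← lintegral_const_mul' _ _ htop1, ← lintegral_const_mul' _ _ htop2,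
    ← lintegral_add_left' hmA, ← lintegral_const_mul' _ _ htopK]
  exact lintegral_mono fun s => lintegral_normalisedPressure_sub_rpow_le hP1 hPtop hC
    (contDiff_slice hv s) (hasCompactSupport_slice' hvc s) (contDiff_slice hw s)
    (hasCompactSupport_slice' hwc s) ht

end Bounds

/-! ## §3. The `L^P` bounds in norm form on space–time -/

section NormBounds

variable {P : ℝ≥0∞} {C : ℝ≥0} {v w : ℝ × ℝ³ → ℝ³}

/-- **`‖P[w]‖_{L^P(ℝ×ℝ³)} ≤ C ‖w‖²_{L^{2P}(ℝ×ℝ³)}`** for `w ∈ C_c^∞(ℝ × ℝ³)` (the `1/p`-th root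
of the integral form). [folklore] -/
theorem eLpNorm_slicePressure_le (hP1 : 1 < P) (hPtop : P < ⊤)
    (hC : ∀ ε : ℝ, 0 < ε → ∀ w : ℝ³ → ℝ³, Continuous w → HasCompactSupport w →
      eLpNorm (regPressure ε w) P volume ≤ C * eLpNorm (fun y => ‖w y‖ ^ 2) P volume)
    (hw : ContDiff ℝ ∞ w) (hwc : HasCompactSupport w) :
    eLpNorm (slicePressure w) P volume ≤ C * eLpNorm w (P * 2) volume ^ 2 := by
  have hP0 : P ≠ 0 := (zero_lt_one.trans hP1).ne'
  have hPt : P ≠ ⊤ := hPtop.ne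
  have hP20 : P * 2 ≠ 0 := mul_ne_zero hP0 two_ne_zero
  have hP2t : P * 2 ≠ ⊤ := ENNReal.mul_ne_top hPt ENNReal.ofNat_ne_top
  have hp : 0 < P.toReal := ENNReal.toReal_pos hP0 hPt
  have h := lintegral_slicePressure_rpow_le hP1 hPtop hC hw hwc
  rw [lintegral_enorm_rpow_eq_eLpNorm_rpow volume _ hP0 hPt,
    lintegral_enorm_rpow_eq_eLpNorm_rpow volume _ hP20 hP2t, toReal_mul_two, ← sq_rpow_eq_rpow_two_mul,
    ← ENNReal.mul_rpow_of_nonneg _ _ hp.le] at h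
  exact (ENNReal.rpow_le_rpow_iff hp).1 h

/-- **The difference bound in norm form on space–time**: for `v, w ∈ C_c^∞(ℝ × ℝ³)` and `t > 0`,
`‖P[v] − P[w]‖_P ≤ 2C (t² · 2‖v + w‖²_{2P} + t⁻² · 2‖v − w‖²_{2P})` — the shape of the slice-wise
`eLpNorm_normalisedPressure_sub_le_of_reg` with the constant doubled (`(xᵖ + yᵖ)^{1/p} ≤ x + y`,
`2^{(p−1)/p} ≤ 2`). [folklore] -/
theorem eLpNorm_slicePressure_sub_le (hP1 : 1 < P) (hPtop : P < ⊤)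
    (hC : ∀ ε : ℝ, 0 < ε → ∀ w : ℝ³ → ℝ³, Continuous w → HasCompactSupport w →
      eLpNorm (regPressure ε w) P volume ≤ C * eLpNorm (fun y => ‖w y‖ ^ 2) P volume)
    (hv : ContDiff ℝ ∞ v) (hvc : HasCompactSupport v) (hw : ContDiff ℝ ∞ w)
    (hwc : HasCompactSupport w) {t : ℝ} (ht : 0 < t) :
    eLpNorm (fun z => slicePressure v z - slicePressure w z) P volume ≤
      (2 * C : ℝ≥0∞) * (ENNReal.ofReal (t ^ 2) * (2 * eLpNorm (v + w) (P * 2) volume ^ 2) +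
        ENNReal.ofReal (t⁻¹ ^ 2) * (2 * eLpNorm (v - w) (P * 2) volume ^ 2)) := by
  have hP0 : P ≠ 0 := (zero_lt_one.trans hP1).ne'
  have hPt : P ≠ ⊤ := hPtop.ne
  have hP20 : P * 2 ≠ 0 := mul_ne_zero hP0 two_ne_zero
  have hP2t : P * 2 ≠ ⊤ := ENNReal.mul_ne_top hPt ENNReal.ofNat_ne_top
  have hp : 0 < P.toReal := ENNReal.toReal_pos hP0 hPt
  have hp1 : 1 ≤ P.toReal := by
    have := (ENNReal.toReal_le_toReal ENNReal.one_ne_top hPt).2 hP1.le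
    simpa using this
  set α : ℝ≥0∞ := ENNReal.ofReal (t ^ 2) with hα
  set β : ℝ≥0∞ := ENNReal.ofReal (t⁻¹ ^ 2) with hβ
  set Np : ℝ≥0∞ := eLpNorm (v + w) (P * 2) volume with hNp
  set Nm : ℝ≥0∞ := eLpNorm (v - w) (P * 2) volume with hNm
  have h := lintegral_slicePressure_sub_rpow_le hP1 hPtop hC hv hvc hw hwc ht
  -- rewrite the integrals as powers of norms
  have e1 : ∫⁻ z, ‖v z + w z‖ₑ ^ (P * 2).toReal = (Np ^ 2) ^ P.toReal := by
    rw [show (∫⁻ z, ‖v z + w z‖ₑ ^ (P * 2).toReal) = ∫⁻ z, ‖(v + w) z‖ₑ ^ (P * 2).toReal from rfl,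
      lintegral_enorm_rpow_eq_eLpNorm_rpow volume _ hP20 hP2t, toReal_mul_two, ← sq_rpow_eq_rpow_two_mul]
  have e2 : ∫⁻ z, ‖v z - w z‖ₑ ^ (P * 2).toReal = (Nm ^ 2) ^ P.toReal := by
    rw [show (∫⁻ z, ‖v z - w z‖ₑ ^ (P * 2).toReal) = ∫⁻ z, ‖(v - w) z‖ₑ ^ (P * 2).toReal from rfl,
      lintegral_enorm_rpow_eq_eLpNorm_rpow volume _ hP20 hP2t, toReal_mul_two, ← sq_rpow_eq_rpow_two_mul]
  rw [lintegral_enorm_rpow_eq_eLpNorm_rpow volume _ hP0 hPt, e1, e2,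
    ← ENNReal.mul_rpow_of_nonneg _ _ hp.le, ← ENNReal.mul_rpow_of_nonneg _ _ hp.le] at h
  -- `L ≤ (K (aᵖ + bᵖ))^{1/p}`
  set a : ℝ≥0∞ := α * 2 * Np ^ 2 with ha
  set b : ℝ≥0∞ := β * 2 * Nm ^ 2 with hb
  set K : ℝ≥0∞ := 2 ^ (P.toReal - 1) * (C : ℝ≥0∞) ^ P.toReal with hK
  have h1 : eLpNorm (fun z => slicePressure v z - slicePressure w z) P volume ≤
      (K * (a ^ P.toReal + b ^ P.toReal)) ^ (1 / P.toReal) := by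
    have h' := ENNReal.rpow_le_rpow h (one_div_nonneg.2 hp.le)
    rwa [← ENNReal.rpow_mul, mul_one_div_cancel hp.ne', ENNReal.rpow_one] at h'
  -- `(aᵖ + bᵖ)^{1/p} ≤ a + b` and `K^{1/p} ≤ 2C`
  have h2 : (a ^ P.toReal + b ^ P.toReal) ^ (1 / P.toReal) ≤ a + b := ENNReal.rpow_add_rpow_le_add a b hp1
  have h3 : K ^ (1 / P.toReal) ≤ 2 * C := by
    rw [hK, ENNReal.mul_rpow_of_nonneg _ _ (one_div_nonneg.2 hp.le), ← ENNReal.rpow_mul,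
      ← ENNReal.rpow_mul, mul_one_div_cancel hp.ne', ENNReal.rpow_one]
    refine mul_le_mul' ?_ le_rfl
    calc (2 : ℝ≥0∞) ^ ((P.toReal - 1) * (1 / P.toReal)) ≤ 2 ^ (1 : ℝ) := by
          refine ENNReal.rpow_le_rpow_of_exponent_le one_le_two ?_
          rw [mul_one_div, div_le_one hp]; linarith
      _ = 2 := ENNReal.rpow_one 2
  calc eLpNorm (fun z => slicePressure v z - slicePressure w z) P volume
      ≤ (K * (a ^ P.toReal + b ^ P.toReal)) ^ (1 / P.toReal) := h1
    _ = K ^ (1 / P.toReal) * (a ^ P.toReal + b ^ P.toReal) ^ (1 / P.toReal) :=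
        ENNReal.mul_rpow_of_nonneg _ _ (one_div_nonneg.2 hp.le)
    _ ≤ (2 * C) * (a + b) := mul_le_mul' h3 h2
    _ = _ := by rw [ha, hb]; ring

end NormBounds

/-! ## §4. The construction -/

section Construction

/-- **The space–time Riesz pressure of an `L^{2q}(ℝ × ℝ³)` field at a general exponent
`1 < q < ∞`.** There is `C` such that every `u ∈ L^{2q}(ℝ × ℝ³; ℝ³)` admits a pressure field
`Q ∈ L^q(ℝ × ℝ³)` with `‖Q‖_q ≤ C ‖u‖²_{2q}` whose slices are, for a.e. time `s`, the Riesz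
pressures of the slices of `u`: `u(s,·) ∈ L^{2q}(ℝ³)`, `Q(s,·) ∈ L^q(ℝ³)` and
`∫ Q(s,·) Δφ = −∫ D²φ(u(s,·), u(s,·))` for all `φ ∈ C_c^∞(ℝ³)` (`−ΔQ(s) = ∂ᵢ∂ⱼ(uᵢuⱼ)(s)`, i.e.
`Q(s) = Σ RᵢRⱼ(uᵢuⱼ)(s)`). Proof: the construction of the tree's `exists_rieszPressure`
(NRŠ 1996 §2 / Tsai 1998 Lemma 2.1: approximation by test fields, the Calderón–Zygmund bound
with polarisation for differences, completeness of `L^q`) run on space–time with the slice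
pressure fields `P[wₙ]` of smooth compactly supported approximants `wₙ → u` in `L^{2q}(ℝ × ℝ³)`
(jointly measurable as pointwise limits of the jointly continuous regularised slice pressures);
the rates `‖wₙ − u‖_{2q} ≤ 2⁻ⁿ`, `‖P[wₙ] − Q‖_q ≲ 2⁻ⁿ` make the slice distances summable in `n`
for a.e. `s` (Tonelli), so that the weak Poisson equations of the slices `p̃[wₙ(s)]` pass to the
limit slice by slice (Hölder). This is the pressure
`p̃_ε = Σ RᵢRⱼ[(η_ε*Uᵢ)Uⱼ + WᵢUⱼ + UᵢWⱼ + WᵢWⱼ] ∈ L^{5/3}(ℝ³ × [0,T])` of [BT1], proof of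
Thm 2.4, for fields with no time regularity (compare `exists_spaceTime_rieszPressure_of_memLp`,
the `L³ → L^{3/2}` case along the canonical operator `rieszPressure`).
[cite: NecasRuzickaSverak1996, §2 p. 285 (with [CZ], [St])] [cite: BradshawTsai2017AHP, proof of Thm 2.4 (the pressure p̃_ε, "apply the Calderon–Zygmund theory")] -/
theorem exists_spaceTime_rieszPressure {q : ℝ} (hq : 1 < q) :
    ∃ C : ℝ≥0, ∀ u : ℝ × ℝ³ → ℝ³, MemLp u (ENNReal.ofReal q * 2) volume →
      ∃ Q : ℝ × ℝ³ → ℝ, MemLp Q (ENNReal.ofReal q) volume ∧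
        eLpNorm Q (ENNReal.ofReal q) volume ≤ C * eLpNorm u (ENNReal.ofReal q * 2) volume ^ 2 ∧
        ∀ᵐ s : ℝ, MemLp (fun y => u (s, y)) (ENNReal.ofReal q * 2) volume ∧
          MemLp (fun y => Q (s, y)) (ENNReal.ofReal q) volume ∧
          ∀ φ : ℝ³ → ℝ, ContDiff ℝ (⊤ : ℕ∞) φ → HasCompactSupport φ →
            ∫ y, Q (s, y) * (Δ φ) y = -∫ y, fderiv ℝ (fderiv ℝ φ) y (u (s, y)) (u (s, y)) := by
  have hq0 : 0 < q := by linarith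
  set P : ℝ≥0∞ := ENNReal.ofReal q with hPdef
  have hP1 : 1 < P := by
    rw [hPdef, ← ENNReal.ofReal_one]; exact (ENNReal.ofReal_lt_ofReal_iff hq0).2 hq
  have hP1' : 1 ≤ P := hP1.le
  have hPtop : P < ⊤ := ENNReal.ofReal_lt_top
  have hP0 : P ≠ 0 := (zero_lt_one.trans hP1).ne'
  have hPt : P ≠ ⊤ := hPtop.ne
  have hP21 : 1 ≤ P * 2 := hP1'.trans (le_mul_of_one_le_right zero_le one_le_two)
  have hP20 : P * 2 ≠ 0 := mul_ne_zero hP0 two_ne_zero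
  have hP2top : P * 2 ≠ ⊤ := ENNReal.mul_ne_top hPtop.ne ENNReal.ofNat_ne_top
  have hp : 0 < P.toReal := ENNReal.toReal_pos hP0 hPt
  have hp1 : 1 ≤ P.toReal := by
    have := (ENNReal.toReal_le_toReal ENNReal.one_ne_top hPt).2 hP1.le
    simpa using this
  have hp2 : 0 < (P * 2).toReal := ENNReal.toReal_pos hP20 hP2top
  have hp21 : 1 ≤ (P * 2).toReal := by rw [toReal_mul_two]; linarith
  obtain ⟨C, hC⟩ := exists_eLpNorm_regPressure_le hP1 hPtop
  refine ⟨C, fun u hU => ?_⟩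
  have hUm := hU.aestronglyMeasurable
  set NU : ℝ≥0∞ := eLpNorm u (P * 2) volume with hNUdef
  have hNUtop : NU ≠ ⊤ := hU.eLpNorm_ne_top
  -- ## approximation by smooth compactly supported space–time fields: `‖u - wₙ‖_{2P} ≤ 2⁻ⁿ`
  have happrox : ∀ n : ℕ, ∃ w : ℝ × ℝ³ → ℝ³, HasCompactSupport w ∧ ContDiff ℝ ∞ w ∧
      eLpNorm (u - w) (P * 2) volume ≤ ENNReal.ofReal ((1 / 2 : ℝ) ^ n) :=
    fun n => hU.exist_eLpNorm_sub_le hP2top hP21 (by positivity)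
  choose w hwc hws hwU using happrox
  set δ : ℕ → ℝ≥0∞ := fun n => (2⁻¹ : ℝ≥0∞) ^ n with hδdef
  have hδof : ∀ n : ℕ, ENNReal.ofReal ((1 / 2 : ℝ) ^ n) = δ n := fun n => by
    rw [hδdef, ENNReal.ofReal_pow (by norm_num), one_div, ENNReal.ofReal_inv_of_pos two_pos,
      ENNReal.ofReal_ofNat]
  have hwU' : ∀ n, eLpNorm (u - w n) (P * 2) volume ≤ δ n := fun n => (hwU n).trans_eq (hδof n)
  have hδle : ∀ n, δ n ≤ 1 := fun n => pow_le_one₀ zero_le (ENNReal.inv_le_one.2 one_le_two)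
  have hδmono : ∀ {N n : ℕ}, N ≤ n → δ n ≤ δ N := fun h =>
    pow_le_pow_right_of_le_one' (ENNReal.inv_le_one.2 one_le_two) h
  have hδ0 : ∀ n, δ n ≠ 0 := fun n => pow_ne_zero _ (ENNReal.inv_ne_zero.2 ENNReal.ofNat_ne_top)
  have hδtop : ∀ n, δ n ≠ ⊤ := fun n => ENNReal.pow_ne_top (ENNReal.inv_ne_top.2 two_ne_zero)
  have hδlim : Tendsto δ atTop (𝓝 0) :=
    ENNReal.tendsto_pow_atTop_nhds_zero_of_lt_one (ENNReal.inv_lt_one.2 ENNReal.one_lt_two)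
  have hδsum : ∑' n, δ n = 2 := by
    rw [hδdef, ENNReal.tsum_geometric, ENNReal.one_sub_inv_two, inv_inv]
  have h2δ : ∀ n : ℕ, (2 : ℝ≥0∞) ^ n * δ n = 1 := fun n => by
    rw [hδdef, ← mul_pow, ENNReal.mul_inv_cancel two_ne_zero ENNReal.ofNat_ne_top, one_pow]
  -- ## norms of the approximants
  have hwm : ∀ n, AEStronglyMeasurable (w n) volume := fun n =>
    (hws n).continuous.aestronglyMeasurable
  have hwLp : ∀ n, MemLp (w n) (P * 2) volume := fun n =>
    (hws n).continuous.memLp_of_hasCompactSupport (hwc n)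
  have hwN : ∀ n, eLpNorm (w n) (P * 2) volume ≤ NU + δ n := fun n => by
    calc eLpNorm (w n) (P * 2) volume = eLpNorm (u - (u - w n)) (P * 2) volume := by
          rw [sub_sub_cancel]
      _ ≤ eLpNorm u (P * 2) volume + eLpNorm (u - w n) (P * 2) volume :=
          eLpNorm_sub_le hUm (hUm.sub (hwm n)) hP21
      _ ≤ NU + δ n := add_le_add le_rfl (hwU' n)
  have hwN1 : ∀ n, eLpNorm (w n) (P * 2) volume ≤ NU + 1 := fun n =>
    (hwN n).trans (add_le_add le_rfl (hδle n))
  have hwdiff : ∀ {N n m : ℕ}, N ≤ n → N ≤ m → eLpNorm (w n - w m) (P * 2) volume ≤ 2 * δ N := by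
    intro N n m hn hm
    calc eLpNorm (w n - w m) (P * 2) volume
        = eLpNorm ((w n - u) + (u - w m)) (P * 2) volume := by rw [sub_add_sub_cancel]
      _ ≤ eLpNorm (w n - u) (P * 2) volume + eLpNorm (u - w m) (P * 2) volume :=
          eLpNorm_add_le ((hwm n).sub hUm) (hUm.sub (hwm m)) hP21
      _ ≤ δ n + δ m := add_le_add (by rw [eLpNorm_sub_comm]; exact hwU' n) (hwU' m)
      _ ≤ δ N + δ N := add_le_add (hδmono hn) (hδmono hm)
      _ = 2 * δ N := (two_mul _).symm
  have hwsum : ∀ n m, eLpNorm (w n + w m) (P * 2) volume ≤ 2 * (NU + 1) := fun n m =>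
    (eLpNorm_add_le (hwm n) (hwm m) hP21).trans
      ((add_le_add (hwN1 n) (hwN1 m)).trans (two_mul _).symm.le)
  -- ## the slice pressure fields of the approximants form a Cauchy sequence in `L^P(ℝ × ℝ³)`
  set f : ℕ → ℝ × ℝ³ → ℝ := fun n => slicePressure (w n) with hfdef
  have hfm : ∀ n, AEStronglyMeasurable (f n) volume := fun n =>
    (stronglyMeasurable_slicePressure (hws n) (hwc n)).aestronglyMeasurable
  have hfbound : ∀ n, eLpNorm (f n) P volume ≤ C * eLpNorm (w n) (P * 2) volume ^ 2 := fun n =>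
    eLpNorm_slicePressure_le hP1 hPtop hC (hws n) (hwc n)
  have hfP : ∀ n, MemLp (f n) P volume := fun n =>
    ⟨hfm n, (hfbound n).trans_lt (ENNReal.mul_lt_top ENNReal.coe_lt_top
      (ENNReal.pow_lt_top (hwLp n).eLpNorm_lt_top))⟩
  set K₁ : ℝ≥0∞ := (2 * C : ℝ≥0∞) * (2 * (2 * (NU + 1)) ^ 2 + 8) with hK₁def
  have hK₁top : K₁ ≠ ⊤ := by
    refine ENNReal.mul_ne_top (ENNReal.mul_ne_top ENNReal.ofNat_ne_top ENNReal.coe_ne_top)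
      (ENNReal.add_ne_top.2 ⟨?_, by norm_num⟩)
    exact ENNReal.mul_ne_top (by norm_num) (ENNReal.pow_ne_top
      (ENNReal.mul_ne_top (by norm_num) (ENNReal.add_ne_top.2 ⟨hNUtop, ENNReal.one_ne_top⟩)))
  have hcau_le : ∀ N n m, N ≤ n → N ≤ m → eLpNorm (f n - f m) P volume ≤ K₁ * δ N := by
    intro N n m hn hm
    set t : ℝ := Real.sqrt ((1 / 2 : ℝ) ^ N) with htdef
    have hhalf : (0 : ℝ) < (1 / 2 : ℝ) ^ N := by positivity
    have ht : 0 < t := Real.sqrt_pos.2 hhalf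
    have ht2 : t ^ 2 = (1 / 2 : ℝ) ^ N := Real.sq_sqrt hhalf.le
    have hti2 : t⁻¹ ^ 2 = (2 : ℝ) ^ N := by rw [inv_pow, ht2, one_div, inv_pow, inv_inv]
    have e1 : ENNReal.ofReal (t ^ 2) = δ N := by rw [ht2, hδof]
    have e2 : ENNReal.ofReal (t⁻¹ ^ 2) = 2 ^ N := by
      rw [hti2, ENNReal.ofReal_pow zero_le_two, ENNReal.ofReal_ofNat]
    have key := eLpNorm_slicePressure_sub_le hP1 hPtop hC (hws n) (hwc n) (hws m) (hwc m) ht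
    rw [e1, e2] at key
    refine (le_of_eq rfl).trans (key.trans ?_)
    calc (2 * C : ℝ≥0∞) * (δ N * (2 * eLpNorm (w n + w m) (P * 2) volume ^ 2) +
          2 ^ N * (2 * eLpNorm (w n - w m) (P * 2) volume ^ 2))
        ≤ (2 * C : ℝ≥0∞) * (δ N * (2 * (2 * (NU + 1)) ^ 2) + 2 ^ N * (2 * (2 * δ N) ^ 2)) := by
          gcongr
          · exact hwsum n m
          · exact hwdiff hn hm
      _ = (2 * C : ℝ≥0∞) * (δ N * (2 * (2 * (NU + 1)) ^ 2) + 8 * δ N * (2 ^ N * δ N)) := by ring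
      _ = K₁ * δ N := by rw [h2δ, hK₁def]; ring
  set B : ℕ → ℝ≥0∞ := fun N => (K₁ + 1) * δ N with hBdef
  have hB : ∑' N, B N ≠ ⊤ := by
    rw [hBdef, ENNReal.tsum_mul_left, hδsum]
    exact ENNReal.mul_ne_top (ENNReal.add_ne_top.2 ⟨hK₁top, ENNReal.one_ne_top⟩) ENNReal.ofNat_ne_top
  have hcau : ∀ N n m : ℕ, N ≤ n → N ≤ m → eLpNorm (f n - f m) P volume < B N := by
    intro N n m hn hm
    refine (hcau_le N n m hn hm).trans_lt ?_
    rw [hBdef]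
    exact ENNReal.mul_lt_mul_left (hδ0 N) (hδtop N) (ENNReal.lt_add_right hK₁top one_ne_zero)
  obtain ⟨Q, hQ, hlim⟩ := Lp.cauchy_complete_eLpNorm (μ := volume) hP1' hfP hB hcau
  -- ## the rate `‖fₙ - Q‖_P ≤ K₁ 2⁻ⁿ`
  have hrate : ∀ n, eLpNorm (f n - Q) P volume ≤ K₁ * δ n := by
    intro n
    have hle : ∀ m, n ≤ m → eLpNorm (f n - Q) P volume ≤ K₁ * δ n + eLpNorm (f m - Q) P volume := by
      intro m hm
      calc eLpNorm (f n - Q) P volume = eLpNorm ((f n - f m) + (f m - Q)) P volume := by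
            rw [sub_add_sub_cancel]
        _ ≤ eLpNorm (f n - f m) P volume + eLpNorm (f m - Q) P volume :=
            eLpNorm_add_le ((hfm n).sub (hfm m)) ((hfm m).sub hQ.1) hP1'
        _ ≤ K₁ * δ n + eLpNorm (f m - Q) P volume := add_le_add (hcau_le n n m le_rfl hm) le_rfl
    have hT : Tendsto (fun m => K₁ * δ n + eLpNorm (f m - Q) P volume) atTop (𝓝 (K₁ * δ n + 0)) :=
      tendsto_const_nhds.add hlim
    rw [add_zero] at hT
    exact ge_of_tendsto hT (eventually_atTop.2 ⟨n, hle⟩)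
  refine ⟨Q, hQ, ?_, ?_⟩
  · -- ## the norm bound
    have hle : ∀ n, eLpNorm Q P volume ≤ eLpNorm (f n - Q) P volume + C * (NU + δ n) ^ 2 := by
      intro n
      calc eLpNorm Q P volume = eLpNorm (f n - (f n - Q)) P volume := by rw [sub_sub_cancel]
        _ ≤ eLpNorm (f n) P volume + eLpNorm (f n - Q) P volume :=
            eLpNorm_sub_le (hfP n).1 ((hfP n).1.sub hQ.1) hP1'
        _ ≤ C * eLpNorm (w n) (P * 2) volume ^ 2 + eLpNorm (f n - Q) P volume :=
            add_le_add (hfbound n) le_rfl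
        _ ≤ C * (NU + δ n) ^ 2 + eLpNorm (f n - Q) P volume := by gcongr; exact hwN n
        _ = _ := add_comm _ _
    have hT : Tendsto (fun n => eLpNorm (f n - Q) P volume + C * (NU + δ n) ^ 2) atTop
        (𝓝 (0 + C * (NU + 0) ^ 2)) :=
      hlim.add (ENNReal.Tendsto.const_mul (ENNReal.Tendsto.pow (n := 2)
        (tendsto_const_nhds.add hδlim)) (Or.inr ENNReal.coe_ne_top))
    have h := ge_of_tendsto' hT hle
    simpa using h
  · -- ## the slices
    -- summable space–time distances, in the integral currency
    have hsum1 : ∑' n, ∫⁻ z, ‖(f n - Q) z‖ₑ ^ P.toReal ≠ ⊤ := by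
      have hle : ∀ n, ∫⁻ z, ‖(f n - Q) z‖ₑ ^ P.toReal ≤ K₁ ^ P.toReal * δ n := by
        intro n
        rw [lintegral_enorm_rpow_eq_eLpNorm_rpow volume _ hP0 hPt]
        calc eLpNorm (f n - Q) P volume ^ P.toReal ≤ (K₁ * δ n) ^ P.toReal :=
              ENNReal.rpow_le_rpow (hrate n) hp.le
          _ = K₁ ^ P.toReal * δ n ^ P.toReal := ENNReal.mul_rpow_of_nonneg _ _ hp.le
          _ ≤ K₁ ^ P.toReal * δ n ^ (1 : ℝ) :=
              mul_le_mul' le_rfl (ENNReal.rpow_le_rpow_of_exponent_ge (hδle n) hp1)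
          _ = K₁ ^ P.toReal * δ n := by rw [ENNReal.rpow_one]
      refine ne_top_of_le_ne_top ?_ (ENNReal.tsum_le_tsum hle)
      rw [ENNReal.tsum_mul_left, hδsum]
      exact ENNReal.mul_ne_top (ENNReal.rpow_ne_top_of_nonneg hp.le hK₁top) ENNReal.ofNat_ne_top
    have hsum2 : ∑' n, ∫⁻ z, ‖(w n - u) z‖ₑ ^ (P * 2).toReal ≠ ⊤ := by
      have hle : ∀ n, ∫⁻ z, ‖(w n - u) z‖ₑ ^ (P * 2).toReal ≤ δ n := by
        intro n
        rw [lintegral_enorm_rpow_eq_eLpNorm_rpow volume _ hP20 hP2top]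
        calc eLpNorm (w n - u) (P * 2) volume ^ (P * 2).toReal ≤ δ n ^ (P * 2).toReal := by
              refine ENNReal.rpow_le_rpow ?_ hp2.le
              rw [eLpNorm_sub_comm]; exact hwU' n
          _ ≤ δ n ^ (1 : ℝ) := ENNReal.rpow_le_rpow_of_exponent_ge (hδle n) hp21
          _ = δ n := ENNReal.rpow_one _
      refine ne_top_of_le_ne_top ?_ (ENNReal.tsum_le_tsum hle)
      rw [hδsum]; exact ENNReal.ofNat_ne_top
    have hae1 := ae_tsum_lintegral_slice_ne_top (fun n => (hfm n).sub hQ.1) hsum1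
    have hae2 := ae_tsum_lintegral_slice_ne_top (fun n => (hwm n).sub hUm) hsum2
    have haeU := ae_memLp_slice hP20 hP2top hU
    have haeQ := ae_memLp_slice hP0 hPt hQ
    filter_upwards [hae1, hae2, haeU, haeQ] with s hs1 hs2 hUs hQs
    refine ⟨hUs, hQs, fun φ hφ hφc => ?_⟩
    have hφ2 : ContDiff ℝ 2 φ := contDiff_infty.1 hφ 2
    haveI hT1 : ENNReal.HolderTriple P (ENNReal.ofReal (q / (q - 1))) 1 := holderTriple_conj hq
    -- the slices of the approximants at time `s`
    have hwss : ∀ n, ContDiff ℝ ∞ fun y => w n (s, y) := fun n => contDiff_slice (hws n) s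
    have hwsc : ∀ n, HasCompactSupport fun y => w n (s, y) := fun n => hasCompactSupport_slice' (hwc n) s
    have hwsLp : ∀ n, MemLp (fun y => w n (s, y)) (P * 2) volume := fun n =>
      (hwss n).continuous.memLp_of_hasCompactSupport (hwsc n)
    have hfsP : ∀ n, MemLp (fun y => f n (s, y)) P volume := fun n =>
      memLp_normalisedPressure_of_hasCompactSupport (hwss n) (hwsc n) hq
    -- slice distances tend to `0`
    have hlim1 : Tendsto (fun n => eLpNorm (fun y => f n (s, y) - Q (s, y)) P volume) atTop (𝓝 0) := by
      have h0 : Tendsto (fun n => ∫⁻ y, ‖(f n - Q) (s, y)‖ₑ ^ P.toReal) atTop (𝓝 0) :=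
        ENNReal.tendsto_atTop_zero_of_tsum_ne_top hs1
      have h1 : Tendsto (fun n => (∫⁻ y, ‖(f n - Q) (s, y)‖ₑ ^ P.toReal) ^ (1 / P.toReal)) atTop (𝓝 0) := by
        have := ((ENNReal.continuous_rpow_const (y := (1 / P.toReal))).tendsto 0).comp h0
        rwa [ENNReal.zero_rpow_of_pos (one_div_pos.2 hp)] at this
      refine h1.congr fun n => ?_
      rw [eLpNorm_eq_lintegral_rpow_enorm_toReal hP0 hPt]
      rfl
    have hlim2 : Tendsto (fun n => eLpNorm ((fun y => w n (s, y)) - fun y => u (s, y)) (P * 2) volume)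
        atTop (𝓝 0) := by
      have h0 : Tendsto (fun n => ∫⁻ y, ‖(w n - u) (s, y)‖ₑ ^ (P * 2).toReal) atTop (𝓝 0) :=
        ENNReal.tendsto_atTop_zero_of_tsum_ne_top hs2
      have h1 : Tendsto (fun n => (∫⁻ y, ‖(w n - u) (s, y)‖ₑ ^ (P * 2).toReal) ^ (1 / (P * 2).toReal))
          atTop (𝓝 0) := by
        have := ((ENNReal.continuous_rpow_const (y := (1 / (P * 2).toReal))).tendsto 0).comp h0
        rwa [ENNReal.zero_rpow_of_pos (one_div_pos.2 hp2)] at this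
      refine h1.congr fun n => ?_
      rw [eLpNorm_eq_lintegral_rpow_enorm_toReal hP20 hP2top]
      rfl
    -- a uniform bound for the slices of the approximants
    set S₂ : ℝ≥0∞ := ∑' n, ∫⁻ y, ‖(w n - u) (s, y)‖ₑ ^ (P * 2).toReal with hS₂
    set M : ℝ≥0∞ := eLpNorm (fun y => u (s, y)) (P * 2) volume + S₂ ^ (1 / (P * 2).toReal) with hM
    have hMtop : M ≠ ⊤ := ENNReal.add_ne_top.2 ⟨hUs.eLpNorm_ne_top,
      ENNReal.rpow_ne_top_of_nonneg (one_div_nonneg.2 hp2.le) hs2⟩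
    have hwM : ∀ n, eLpNorm (fun y => w n (s, y)) (P * 2) volume ≤ M := by
      intro n
      have hdist : eLpNorm ((fun y => w n (s, y)) - fun y => u (s, y)) (P * 2) volume ≤
          S₂ ^ (1 / (P * 2).toReal) := by
        rw [eLpNorm_eq_lintegral_rpow_enorm_toReal hP20 hP2top]
        refine ENNReal.rpow_le_rpow ?_ (one_div_nonneg.2 hp2.le)
        exact ENNReal.le_tsum (f := fun n => ∫⁻ y, ‖(w n - u) (s, y)‖ₑ ^ (P * 2).toReal) n
      calc eLpNorm (fun y => w n (s, y)) (P * 2) volume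
          = eLpNorm ((fun y => u (s, y)) + ((fun y => w n (s, y)) - fun y => u (s, y))) (P * 2) volume := by
            rw [add_sub_cancel]
        _ ≤ eLpNorm (fun y => u (s, y)) (P * 2) volume +
            eLpNorm ((fun y => w n (s, y)) - fun y => u (s, y)) (P * 2) volume :=
            eLpNorm_add_le hUs.1 ((hwsLp n).1.sub hUs.1) hP21
        _ ≤ M := add_le_add le_rfl hdist
    -- each approximant: `∫ p̃[wₙ(s)] Δφ = -∫ D²φ(wₙ(s), wₙ(s))`
    have hn : ∀ n, ∫ y, f n (s, y) * (Δ φ) y = -∫ y, fderiv ℝ (fderiv ℝ φ) y (w n (s, y)) (w n (s, y)) := by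
      intro n
      have h := integral_normalisedPressure_mul_laplacian (hwss n) (hwsc n) hφ2 hφc
      rw [hfdef]
      simp only [slicePressure_apply]
      linarith
    -- left-hand sides converge
    have hΔc : Continuous (Δ φ) := FluidPDE.continuous_laplacian hφ2
    have hΔs : HasCompactSupport (Δ φ) :=
      hφc.mono' fun x hx => by
        contrapose! hx
        simp [FluidPDE.laplacian_eq_zero_of_notMem_tsupport hx]
    have hΔLp : MemLp (Δ φ) (ENNReal.ofReal (q / (q - 1))) volume := hΔc.memLp_of_hasCompactSupport hΔs
    have iQ : Integrable fun y => Q (s, y) * (Δ φ) y := by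
      simpa only [smul_eq_mul] using (hQs.locallyIntegrable hP1').integrable_smul_right_of_hasCompactSupport hΔc hΔs
    have ifn : ∀ n, Integrable fun y => f n (s, y) * (Δ φ) y := fun n => by
      simpa only [smul_eq_mul] using
        ((hfsP n).locallyIntegrable hP1').integrable_smul_right_of_hasCompactSupport hΔc hΔs
    have hL : Tendsto (fun n => ∫ y, f n (s, y) * (Δ φ) y) atTop (𝓝 (∫ y, Q (s, y) * (Δ φ) y)) := by
      have h0 := tendsto_integral_mul_of_eLpNorm_tendsto_zero (P := P)
        (Q' := ENNReal.ofReal (q / (q - 1))) (g := fun n => fun y => f n (s, y) - Q (s, y)) (ψ := Δ φ)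
        (fun n => (hfsP n).1.sub hQs.1) hΔLp hlim1
      have e : ∀ n, ∫ y, (f n (s, y) - Q (s, y)) * (Δ φ) y =
          (∫ y, f n (s, y) * (Δ φ) y) - ∫ y, Q (s, y) * (Δ φ) y := by
        intro n
        rw [← integral_sub (ifn n) iQ]
        refine integral_congr_ae (ae_of_all _ fun y => ?_)
        ring
      simp_rw [e] at h0
      exact tendsto_sub_nhds_zero_iff.1 h0
    -- right-hand sides converge
    have hR := tendsto_integral_hessian_apply_of_eLpNorm hq hUs hwsLp hMtop hwM hlim2 hφ2 hφc
    have hL' : Tendsto (fun n => ∫ y, f n (s, y) * (Δ φ) y) atTop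
        (𝓝 (-∫ y, fderiv ℝ (fderiv ℝ φ) y (u (s, y)) (u (s, y)))) := by
      simp_rw [hn]
      exact hR.neg
    exact tendsto_nhds_unique hL hL'

end Construction

end RieszPressureLq

end Literature.Analysis.FluidPDE
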